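import Literature.NumberTheory.Transcendental.ChudnovskyAnalytic
import Literature.NumberTheory.Transcendental.SigmaLatticeAutomorphy
import Literature.NumberTheory.Transcendental.MasserThmIDerivation
import Mathlib.Analysis.Complex.Liouville
import Mathlib.Analysis.Calculus.IteratedDeriv.Lemmas
import HarnessLib

/-!
# Masser 1975, Theorem I — the analytic half (Lemmas 1.9–1.11: entire multiplier, growth, `σ`-bounds)

Support for the proof of Theorem I (a transcendence measure for `τ = ω₂/ω₁`) of D. W. Masser,
*Elliptic Functions and Transcendence*, LNM 437 (1975), Ch. I §1.3, on the book's own line towards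
Theorem II (`Literature.NumberTheory.Transcendental.masser_ellipticPeriods`).

The auxiliary function `Φ(z) = ∑ p(λ₁,λ₂) ℘(ω₁z)^{λ₁} ℘(ω₂z)^{λ₂}` (`biEval`) has poles; the book
multiplies it by `P(z) = ∏_{i=1,2} ∏_{|Ωᵢ| ≤ |ωᵢ|Z} (ωᵢz - Ωᵢ)^{2L}` (Lemma 1.9). We use instead the
ENTIRE multiplier `σ(ω₁z)^{2L} σ(ω₂z)^{2L}` (`sigmaMult`), exactly as in the tree's proofs of the
theorems of Schneider and Chudnovsky (`SchneiderPeriodsAnalytic.lean`, `ChudnovskyAnalytic.lean`):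

* `Gfun` — the entire function `∑ p(λ₁,λ₂) (σ²℘)(ω₁z)^{λ₁} σ(ω₁z)^{2(L-λ₁)} (σ²℘)(ω₂z)^{λ₂}
  σ(ω₂z)^{2(L-λ₂)} = σ(ω₁z)^{2L} σ(ω₂z)^{2L} Φ(z)` (`Gfun_eq`), its order-two growth
  `‖G(z)‖ ≤ (∑|p|) exp(C(L+1)(1+|z|²))` (`norm_Gfun_le`; Lemma 1.9's `|φ(z)| < H^{c₉k} Z^{c₁₀LZ²}`)
  and the same bound for the multiplier (`norm_sigmaMult_le`);
* `le_norm_sigmaMult_of_mem_xiSet` — on Masser's set `ξ` the multiplier is not too small,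
  `‖σ(ω₁z)^{2L}σ(ω₂z)^{2L}‖ ≥ (c e^{-C(1+|z|²)})^{4L}` (quasi-periodicity of `|σ|`,
  `PeriodPair.norm_weierstrassSigma_add_lattice`, and `min |σ| > 0` on the compact `ωᵢ𝒟`), whence
  `‖Φ(z)‖ ≤ ‖G(z)‖ (c⁻¹e^{C(1+|z|²)})^{4L}` on `ξ` (`norm_biEval_le_of_mem_xiSet`; the book's
  "`|P(ζ)| > 1`");
* `norm_iteratedDeriv_Gfun_le` — Leibniz and Cauchy: at a regular point `c`,
  `‖G^{(m)}(c)‖ ≤ ∑_j binom(m,j) (m-j)! e^{C(L+1)(1+(|c|+1)²)} ‖Φ^{(j)}(c)‖` (Lemma 1.10, (13));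
* `norm_iteratedDeriv_biEval_quarter_le` — Cauchy's inequality on `∂𝒟`:
  `‖Φ^{(m)}(¼)‖ ≤ m! ρ^{-m} max_{∂𝒟} |Φ|` (end of the proof of Lemma 1.10).

Everything here is proved; no named facts. The maximum-modulus step with approximate zeros is
`MasserApproxSchwarz.lean`; the arithmetic and the endgame are the sequel.

## References

* D. W. Masser, *Elliptic Functions and Transcendence*, Lecture Notes in Math. 437, Springer 1975,
  Ch. I §1.3, Lemmas 1.9–1.11 (pp. 6–10). [Masser1975]
-/

noncomputable section

open Complex Metric Set Filter Finset
open _root_.Topology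
open scoped PeriodPair

namespace Literature.NumberTheory.Transcendental.Masser1975

open Literature.NumberTheory.Transcendental.Chudnovsky (Sp differentiable_Sp
  sigma_sq_mul_weierstrassP exists_bound_Sg_Sp_sigma one_add_le_exp_one_add_sq)

variable (L : PeriodPair)

/-! ### The entire function `G = σ(ω₁z)^{2n} σ(ω₂z)^{2n} Φ` -/

/-- The multiplier `σ(ω₁ z)^{2n} σ(ω₂ z)^{2n}` (entire). [cite: Masser1975, Lemma 1.9 (the factor P(z))] -/
def sigmaMult (n : ℕ) (z : ℂ) : ℂ :=
  L.weierstrassSigma (L.ω₁ * z) ^ (2 * n) * L.weierstrassSigma (L.ω₂ * z) ^ (2 * n)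

/-- The entire function `G(z) = ∑ p(λ₁,λ₂) (σ²℘)(ω₁z)^{λ₁} σ(ω₁z)^{2(n-λ₁)} (σ²℘)(ω₂z)^{λ₂}
σ(ω₂z)^{2(n-λ₂)}`. [cite: Masser1975, Lemma 1.9 (φ = PΦ)] -/
def Gfun (n : ℕ) (p : ℕ → ℕ → ℂ) (z : ℂ) : ℂ :=
  ∑ i ∈ Finset.range (n + 1), ∑ j ∈ Finset.range (n + 1), p i j *
    ((Sp L (L.ω₁ * z) ^ i * L.weierstrassSigma (L.ω₁ * z) ^ (2 * (n - i))) *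
      (Sp L (L.ω₂ * z) ^ j * L.weierstrassSigma (L.ω₂ * z) ^ (2 * (n - j))))

variable {L}

/-- `(σ²℘)(u)^i σ(u)^{2(n-i)} = σ(u)^{2n} ℘(u)^i` off the lattice (`i ≤ n`). [folklore] -/
theorem Sp_pow_mul_sigma_pow {u : ℂ} (hu : u ∉ L.lattice) {n i : ℕ} (hi : i ≤ n) :
    Sp L u ^ i * L.weierstrassSigma u ^ (2 * (n - i)) =
      L.weierstrassSigma u ^ (2 * n) * ℘[L] u ^ i := by
  rw [← sigma_sq_mul_weierstrassP L hu, mul_pow, ← pow_mul]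
  have : L.weierstrassSigma u ^ (2 * i) * L.weierstrassSigma u ^ (2 * (n - i)) =
      L.weierstrassSigma u ^ (2 * n) := by
    rw [← pow_add]
    congr 1
    omega
  calc L.weierstrassSigma u ^ (2 * i) * ℘[L] u ^ i * L.weierstrassSigma u ^ (2 * (n - i))
      = L.weierstrassSigma u ^ (2 * i) * L.weierstrassSigma u ^ (2 * (n - i)) * ℘[L] u ^ i := by
        ring
    _ = L.weierstrassSigma u ^ (2 * n) * ℘[L] u ^ i := by rw [this]

/-- **`G = σ(ω₁z)^{2n} σ(ω₂z)^{2n} Φ`** at the regular points (both `ωᵢ z ∉ Λ`).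
[cite: Masser1975, Lemma 1.9 (φ = PΦ)] -/
theorem Gfun_eq (n : ℕ) (p : ℕ → ℕ → ℂ) {z : ℂ} (h1 : L.ω₁ * z ∉ L.lattice)
    (h2 : L.ω₂ * z ∉ L.lattice) : Gfun L n p z = sigmaMult L n z * biEval L n p z := by
  unfold Gfun sigmaMult biEval
  simp only [scaledP, PeriodPair.basis_zero, PeriodPair.basis_one, Finset.mul_sum, Finset.sum_mul]
  refine Finset.sum_congr rfl fun i hi => Finset.sum_congr rfl fun j hj => ?_
  have hi' : i ≤ n := Nat.lt_succ_iff.mp (Finset.mem_range.mp hi)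
  have hj' : j ≤ n := Nat.lt_succ_iff.mp (Finset.mem_range.mp hj)
  rw [Sp_pow_mul_sigma_pow h1 hi', Sp_pow_mul_sigma_pow h2 hj']
  ring

variable (L) in
/-- The multiplier is entire. [folklore] -/
theorem differentiable_sigmaMult (n : ℕ) : Differentiable ℂ (sigmaMult L n) := by
  have hσ : Differentiable ℂ L.weierstrassSigma := L.differentiable_weierstrassSigma_holds
  unfold sigmaMult
  fun_prop

variable (L) in
/-- `G` is entire. [cite: Masser1975, Lemma 1.9 ("φ(z) is regular for |z| ≤ Z")] -/
theorem differentiable_Gfun (n : ℕ) (p : ℕ → ℕ → ℂ) : Differentiable ℂ (Gfun L n p) := by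
  have hσ : Differentiable ℂ L.weierstrassSigma := L.differentiable_weierstrassSigma_holds
  have hSp := differentiable_Sp L
  unfold Gfun
  fun_prop

/-! ### Growth -/

variable (L) in
/-- **Order-two growth of the multiplier**: `‖σ(ω₁z)^{2n}σ(ω₂z)^{2n}‖ ≤ exp(C(n+1)(1+|z|²))`.
[cite: Masser1975, Lemma 1.9] -/
theorem norm_sigmaMult_le : ∃ C : ℝ, 0 ≤ C ∧ ∀ (n : ℕ) (z : ℂ),
    ‖sigmaMult L n z‖ ≤ Real.exp (C * (n + 1) * (1 + ‖z‖ ^ 2)) := by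
  obtain ⟨C, hC, h⟩ := exists_bound_Sg_Sp_sigma L
  set W : ℝ := 1 + ‖L.ω₁‖ ^ 2 + ‖L.ω₂‖ ^ 2 with hW
  have hW1 : 1 ≤ W := by
    rw [hW]; have := sq_nonneg ‖L.ω₁‖; have := sq_nonneg ‖L.ω₂‖; linarith
  refine ⟨4 * C * W, by positivity, fun n z => ?_⟩
  have hb : ∀ ω : ℂ, ‖ω‖ ^ 2 ≤ W - 1 → ‖L.weierstrassSigma (ω * z)‖ ≤ Real.exp (C * W * (1 + ‖z‖ ^ 2)) := by
    intro ω hω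
    refine (h (ω * z)).2.2.trans (Real.exp_le_exp.mpr ?_)
    rw [norm_mul, mul_pow]
    have : ‖ω‖ ^ 2 * ‖z‖ ^ 2 ≤ (W - 1) * ‖z‖ ^ 2 := by gcongr
    nlinarith [norm_nonneg z, sq_nonneg ‖z‖]
  have h1 := hb L.ω₁ (by rw [hW]; nlinarith [norm_nonneg L.ω₂])
  have h2 := hb L.ω₂ (by rw [hW]; nlinarith [norm_nonneg L.ω₁])
  have hE1 : (1 : ℝ) ≤ Real.exp (C * W * (1 + ‖z‖ ^ 2)) := Real.one_le_exp (by positivity)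
  unfold sigmaMult
  rw [norm_mul, norm_pow, norm_pow]
  calc ‖L.weierstrassSigma (L.ω₁ * z)‖ ^ (2 * n) * ‖L.weierstrassSigma (L.ω₂ * z)‖ ^ (2 * n)
      ≤ Real.exp (C * W * (1 + ‖z‖ ^ 2)) ^ (2 * n) * Real.exp (C * W * (1 + ‖z‖ ^ 2)) ^ (2 * n) := by
        gcongr
    _ = Real.exp (4 * n * (C * W * (1 + ‖z‖ ^ 2))) := by
        rw [← pow_add, ← Real.exp_nat_mul]; push_cast; ring_nf
    _ ≤ Real.exp (4 * C * W * (n + 1) * (1 + ‖z‖ ^ 2)) := by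
        apply Real.exp_le_exp.mpr
        have : 0 ≤ C * W * (1 + ‖z‖ ^ 2) := by positivity
        nlinarith

variable (L) in
/-- **Order-two growth of `G`** (Lemma 1.9: "`|φ(z)| < H^{c₉k} Z^{c₁₀LZ²}`"):
`‖G(z)‖ ≤ (∑|p|) · exp(C(n+1)(1+|z|²))`. [cite: Masser1975, Lemma 1.9] -/
theorem norm_Gfun_le : ∃ C : ℝ, 0 ≤ C ∧ ∀ (n : ℕ) (p : ℕ → ℕ → ℂ) (z : ℂ),
    ‖Gfun L n p z‖ ≤ coeffSum n p * Real.exp (C * (n + 1) * (1 + ‖z‖ ^ 2)) := by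
  obtain ⟨C, hC, h⟩ := exists_bound_Sg_Sp_sigma L
  set W : ℝ := 1 + ‖L.ω₁‖ ^ 2 + ‖L.ω₂‖ ^ 2 with hW
  have hW1 : 1 ≤ W := by
    rw [hW]; have := sq_nonneg ‖L.ω₁‖; have := sq_nonneg ‖L.ω₂‖; linarith
  refine ⟨4 * C * W, by positivity, fun n p z => ?_⟩
  set E : ℝ := Real.exp (C * W * (1 + ‖z‖ ^ 2)) with hE
  have hE1 : 1 ≤ E := Real.one_le_exp (by positivity)
  have hb : ∀ ω : ℂ, ‖ω‖ ^ 2 ≤ W - 1 →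
      ‖Sp L (ω * z)‖ ≤ E ∧ ‖L.weierstrassSigma (ω * z)‖ ≤ E := by
    intro ω hω
    obtain ⟨-, hSp, hσ⟩ := h (ω * z)
    have harg : C * (1 + ‖ω * z‖ ^ 2) ≤ C * W * (1 + ‖z‖ ^ 2) := by
      rw [norm_mul, mul_pow]
      have : ‖ω‖ ^ 2 * ‖z‖ ^ 2 ≤ (W - 1) * ‖z‖ ^ 2 := by gcongr
      nlinarith [norm_nonneg z, sq_nonneg ‖z‖]
    exact ⟨hSp.trans (Real.exp_le_exp.mpr harg), hσ.trans (Real.exp_le_exp.mpr harg)⟩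
  obtain ⟨hSp1, hσ1⟩ := hb L.ω₁ (by rw [hW]; nlinarith [norm_nonneg L.ω₂])
  obtain ⟨hSp2, hσ2⟩ := hb L.ω₂ (by rw [hW]; nlinarith [norm_nonneg L.ω₁])
  -- each term is bounded by `‖p i j‖ E^{4n}`
  have hterm : ∀ i ∈ Finset.range (n + 1), ∀ j ∈ Finset.range (n + 1),
      ‖p i j * ((Sp L (L.ω₁ * z) ^ i * L.weierstrassSigma (L.ω₁ * z) ^ (2 * (n - i))) *
        (Sp L (L.ω₂ * z) ^ j * L.weierstrassSigma (L.ω₂ * z) ^ (2 * (n - j))))‖ ≤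
        ‖p i j‖ * E ^ (4 * n) := by
    intro i hi j hj
    have hi' : i ≤ n := Nat.lt_succ_iff.mp (Finset.mem_range.mp hi)
    have hj' : j ≤ n := Nat.lt_succ_iff.mp (Finset.mem_range.mp hj)
    rw [norm_mul, norm_mul, norm_mul, norm_mul, norm_pow, norm_pow, norm_pow, norm_pow]
    refine mul_le_mul_of_nonneg_left ?_ (norm_nonneg _)
    calc ‖Sp L (L.ω₁ * z)‖ ^ i * ‖L.weierstrassSigma (L.ω₁ * z)‖ ^ (2 * (n - i)) *
          (‖Sp L (L.ω₂ * z)‖ ^ j * ‖L.weierstrassSigma (L.ω₂ * z)‖ ^ (2 * (n - j)))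
        ≤ E ^ i * E ^ (2 * (n - i)) * (E ^ j * E ^ (2 * (n - j))) := by gcongr
      _ = E ^ (i + 2 * (n - i) + (j + 2 * (n - j))) := by rw [← pow_add, ← pow_add, ← pow_add]
      _ ≤ E ^ (4 * n) := pow_le_pow_right₀ hE1 (by omega)
  calc ‖Gfun L n p z‖ ≤ ∑ i ∈ Finset.range (n + 1), ∑ j ∈ Finset.range (n + 1),
        ‖p i j * ((Sp L (L.ω₁ * z) ^ i * L.weierstrassSigma (L.ω₁ * z) ^ (2 * (n - i))) *
          (Sp L (L.ω₂ * z) ^ j * L.weierstrassSigma (L.ω₂ * z) ^ (2 * (n - j))))‖ := by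
        unfold Gfun
        exact (norm_sum_le _ _).trans (Finset.sum_le_sum fun i _ => norm_sum_le _ _)
    _ ≤ ∑ i ∈ Finset.range (n + 1), ∑ j ∈ Finset.range (n + 1), ‖p i j‖ * E ^ (4 * n) :=
        Finset.sum_le_sum fun i hi => Finset.sum_le_sum fun j hj => hterm i hi j hj
    _ = coeffSum n p * E ^ (4 * n) := by
        rw [coeffSum, Finset.sum_mul]
        refine Finset.sum_congr rfl fun i _ => ?_
        rw [Finset.sum_mul]
    _ ≤ coeffSum n p * Real.exp (4 * C * W * (n + 1) * (1 + ‖z‖ ^ 2)) := by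
        refine mul_le_mul_of_nonneg_left ?_ (coeffSum_nonneg n p)
        rw [hE, ← Real.exp_nat_mul]
        apply Real.exp_le_exp.mpr
        have : 0 ≤ C * W * (1 + ‖z‖ ^ 2) := by positivity
        push_cast
        nlinarith

/-! ### `|σ|` is not too small on `ξ` -/

variable (L) in
/-- The integer coordinates of a lattice vector are bounded by its length:
`|m|, |n| ≤ B ‖m ω₁ + n ω₂‖` (the coordinate functionals of the `ℝ`-basis `(ω₁, ω₂)` are
bounded). [folklore] -/
theorem exists_coord_bound : ∃ B : ℝ, 0 ≤ B ∧ ∀ m n : ℤ,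
    |(m : ℝ)| ≤ B * ‖(m : ℂ) * L.ω₁ + (n : ℂ) * L.ω₂‖ ∧
    |(n : ℝ)| ≤ B * ‖(m : ℂ) * L.ω₁ + (n : ℂ) * L.ω₂‖ := by
  -- the coordinate functionals, as continuous linear maps
  let f : Fin 2 → (ℂ →L[ℝ] ℝ) := fun i => LinearMap.toContinuousLinearMap (L.basis.coord i)
  have hf : ∀ i (z : ℂ), f i z = L.basis.repr z i := fun i z => rfl
  have hrepr : ∀ m n : ℤ, ∀ i, L.basis.repr ((m : ℂ) * L.ω₁ + (n : ℂ) * L.ω₂) i = ![(m : ℝ), (n : ℝ)] i := by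
    intro m n i
    have hz : (m : ℂ) * L.ω₁ + (n : ℂ) * L.ω₂ = (m : ℝ) • L.basis 0 + (n : ℝ) • L.basis 1 := by
      simp [Complex.real_smul]
    rw [hz, map_add, map_smul, map_smul, L.basis.repr_self, L.basis.repr_self]
    fin_cases i <;> simp
  refine ⟨max ‖f 0‖ ‖f 1‖, by positivity, fun m n => ⟨?_, ?_⟩⟩
  · have h := (f 0).le_opNorm ((m : ℂ) * L.ω₁ + (n : ℂ) * L.ω₂)
    rw [hf, hrepr] at h
    simp only [Matrix.cons_val_zero, Real.norm_eq_abs] at h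
    exact h.trans (mul_le_mul_of_nonneg_right (le_max_left _ _) (norm_nonneg _))
  · have h := (f 1).le_opNorm ((m : ℂ) * L.ω₁ + (n : ℂ) * L.ω₂)
    rw [hf, hrepr] at h
    simp only [Matrix.cons_val_one, Matrix.cons_val_zero, Real.norm_eq_abs] at h
    exact h.trans (mul_le_mul_of_nonneg_right (le_max_right _ _) (norm_nonneg _))

/-- **Lower bound for `|σ(ωᵢ z)|` on `ξ`**: there are `c > 0`, `C ≥ 0` with
`‖σ(ωᵢ z)‖ ≥ c · exp(-C (1 + |z|²))` for `z ∈ ξ` and `i = 1, 2` (the representative of `ωᵢz`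
modulo `Λ` lies in the compact set `ωᵢ𝒟` where `σ ≠ 0`; the automorphy factor
`|σ(u+λ)| = e^{Re(η(λ)(u+λ/2))}|σ(u)|` is `≥ e^{-C(1+|z|²)}`).
[cite: Masser1975, Lemma 1.10 (proof, "|P(ζ)| > 1")] -/
theorem le_norm_weierstrassSigma_of_mem_xiSet (d : DiscData L) :
    ∃ c : ℝ, 0 < c ∧ ∃ C : ℝ, 0 ≤ C ∧ ∀ z ∈ xiSet d, ∀ i : Fin 2,
      c * Real.exp (-(C * (1 + ‖z‖ ^ 2))) ≤ ‖L.weierstrassSigma (L.basis i * z)‖ := by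
  -- the compact sets `ωᵢ 𝒟` and the minimum of `|σ|` there
  set K : Fin 2 → Set ℂ := fun i => (fun w => L.basis i * w) '' closedBall (1 / 4 : ℂ) d.ρ with hK
  have hKc : ∀ i, IsCompact (K i) := fun i =>
    (isCompact_closedBall _ _).image (continuous_const.mul continuous_id)
  have hKΛ : ∀ i, ∀ u ∈ K i, u ∉ L.lattice := by
    rintro i u ⟨w, hw, rfl⟩
    exact d.regular i w hw
  have hKne : ∀ i, (K i).Nonempty := fun i =>
    ⟨L.basis i * (1 / 4 : ℂ), ⟨1 / 4, mem_closedBall_self d.ρ_pos.le, rfl⟩⟩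
  have hcont : ∀ i, ContinuousOn (fun u => ‖L.weierstrassSigma u‖) (K i) := fun i =>
    L.differentiable_weierstrassSigma_holds.continuous.norm.continuousOn
  have hmin : ∃ m : ℝ, 0 < m ∧ ∀ i, ∀ u ∈ K i, m ≤ ‖L.weierstrassSigma u‖ := by
    have hmin' : ∀ i, ∃ m : ℝ, 0 < m ∧ ∀ u ∈ K i, m ≤ ‖L.weierstrassSigma u‖ := by
      intro i
      obtain ⟨u₀, hu₀, hmin⟩ := (hKc i).exists_isMinOn (hKne i) (hcont i)
      exact ⟨‖L.weierstrassSigma u₀‖,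
        norm_pos_iff.mpr (L.weierstrassSigma_ne_zero (hKΛ i u₀ hu₀)),
        fun u hu => isMinOn_iff.mp hmin u hu⟩
    obtain ⟨m₀, hm₀, h₀⟩ := hmin' 0
    obtain ⟨m₁, hm₁, h₁⟩ := hmin' 1
    refine ⟨min m₀ m₁, lt_min hm₀ hm₁, fun i u hu => ?_⟩
    fin_cases i
    · exact (min_le_left _ _).trans (h₀ u hu)
    · exact (min_le_right _ _).trans (h₁ u hu)
  obtain ⟨mσ, hmσ, hmσle⟩ := hmin
  -- sizes
  set Ω : ℝ := ‖L.ω₁‖ + ‖L.ω₂‖ with hΩ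
  have hΩi : ∀ i, ‖L.basis i‖ ≤ Ω := by
    intro i; fin_cases i <;> simp [hΩ]
  have hρle : d.ρ ≤ 1 / 4 := d.ρ_le
  have hKbound : ∀ i, ∀ u ∈ K i, ‖u‖ ≤ Ω := by
    rintro i u ⟨w, hw, rfl⟩
    rw [norm_mul]
    have hw' : ‖w‖ ≤ 1 := by
      have h1 : ‖w - 1 / 4‖ ≤ d.ρ := mem_closedBall_iff_norm.mp hw
      calc ‖w‖ = ‖(w - 1 / 4) + 1 / 4‖ := by ring_nf
        _ ≤ ‖w - 1 / 4‖ + ‖(1 / 4 : ℂ)‖ := norm_add_le _ _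
        _ ≤ d.ρ + 1 / 4 := by rw [show ‖(1 / 4 : ℂ)‖ = 1 / 4 by norm_num]; linarith
        _ ≤ 1 := by linarith
    calc ‖L.basis i‖ * ‖w‖ ≤ Ω * 1 := mul_le_mul (hΩi i) hw' (norm_nonneg _) (by positivity)
      _ = Ω := mul_one _
  obtain ⟨B, hB0, hBcoord⟩ := exists_coord_bound L
  set Eη : ℝ := ‖L.η₁‖ + ‖L.η₂‖ with hEη
  -- the constant
  set C : ℝ := 2 * B * Eη * (4 * Ω + 8 * Ω ^ 2) with hC
  refine ⟨mσ, hmσ, C, by positivity, fun z hz i => ?_⟩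
  obtain ⟨l, hl, hw⟩ := hz i
  obtain ⟨m, n, rfl⟩ := L.mem_lattice.mp hl
  set lam : ℂ := (m : ℂ) * L.ω₁ + (n : ℂ) * L.ω₂ with hlam
  set w : ℂ := z - lam / L.basis i with hwdef
  have hu : L.basis i * z = L.basis i * w + lam := by
    rw [hwdef, mul_sub, mul_div_cancel₀ _ (basis_ne_zero L i), sub_add_cancel]
  have hwK : L.basis i * w ∈ K i := ⟨w, hw, rfl⟩
  -- automorphy
  have hnorm := PeriodPair.norm_weierstrassSigma_add_lattice (L := L) m n (L.basis i * w)
  rw [hu, hnorm]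
  -- sizes of `lam` and of the exponent
  have hlam_le : ‖lam‖ ≤ Ω * (‖z‖ + 1) := by
    have : lam = L.basis i * z - L.basis i * w := by rw [hu]; ring
    rw [this, ← mul_sub, norm_mul]
    have hzw : ‖z - w‖ ≤ ‖z‖ + 1 := by
      calc ‖z - w‖ ≤ ‖z‖ + ‖w‖ := norm_sub_le _ _
        _ ≤ ‖z‖ + 1 := by
            have h1 : ‖w - 1 / 4‖ ≤ d.ρ := mem_closedBall_iff_norm.mp hw
            have : ‖w‖ ≤ 1 := by
              calc ‖w‖ = ‖(w - 1 / 4) + 1 / 4‖ := by ring_nf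
                _ ≤ ‖w - 1 / 4‖ + ‖(1 / 4 : ℂ)‖ := norm_add_le _ _
                _ ≤ d.ρ + 1 / 4 := by rw [show ‖(1 / 4 : ℂ)‖ = 1 / 4 by norm_num]; linarith
                _ ≤ 1 := by linarith
            linarith
    exact mul_le_mul (hΩi i) hzw (norm_nonneg _) (by positivity)
  have hη_le : ‖(m : ℂ) * L.η₁ + (n : ℂ) * L.η₂‖ ≤ 2 * B * Eη * ‖lam‖ := by
    obtain ⟨hm, hn⟩ := hBcoord m n
    calc ‖(m : ℂ) * L.η₁ + (n : ℂ) * L.η₂‖ ≤ ‖(m : ℂ) * L.η₁‖ + ‖(n : ℂ) * L.η₂‖ := norm_add_le _ _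
      _ = |(m : ℝ)| * ‖L.η₁‖ + |(n : ℝ)| * ‖L.η₂‖ := by
          rw [norm_mul, norm_mul, Complex.norm_intCast, Complex.norm_intCast]
      _ ≤ B * ‖lam‖ * ‖L.η₁‖ + B * ‖lam‖ * ‖L.η₂‖ := by gcongr
      _ = B * Eη * ‖lam‖ := by rw [hEη]; ring
      _ ≤ 2 * B * Eη * ‖lam‖ := by
          have : 0 ≤ B * Eη * ‖lam‖ := by positivity
          linarith
  have hexp : -(C * (1 + ‖z‖ ^ 2)) ≤
      (((m : ℂ) * L.η₁ + (n : ℂ) * L.η₂) * (L.basis i * w + lam / 2)).re := by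
    have h1 : -‖((m : ℂ) * L.η₁ + (n : ℂ) * L.η₂) * (L.basis i * w + lam / 2)‖ ≤
        (((m : ℂ) * L.η₁ + (n : ℂ) * L.η₂) * (L.basis i * w + lam / 2)).re := by
      have := Complex.abs_re_le_norm (((m : ℂ) * L.η₁ + (n : ℂ) * L.η₂) * (L.basis i * w + lam / 2))
      rw [abs_le] at this
      exact this.1
    refine le_trans ?_ h1
    rw [neg_le_neg_iff, norm_mul]
    have h2 : ‖L.basis i * w + lam / 2‖ ≤ Ω + ‖lam‖ / 2 := by
      calc ‖L.basis i * w + lam / 2‖ ≤ ‖L.basis i * w‖ + ‖lam / 2‖ := norm_add_le _ _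
        _ ≤ Ω + ‖lam‖ / 2 := by
            rw [norm_div, show ‖(2 : ℂ)‖ = 2 by norm_num]
            exact add_le_add (hKbound i _ hwK) le_rfl
    have hz0 := norm_nonneg z
    have hl0 := norm_nonneg lam
    calc ‖(m : ℂ) * L.η₁ + (n : ℂ) * L.η₂‖ * ‖L.basis i * w + lam / 2‖
        ≤ (2 * B * Eη * ‖lam‖) * (Ω + ‖lam‖ / 2) :=
          mul_le_mul hη_le h2 (norm_nonneg _) (by positivity)
      _ ≤ (2 * B * Eη * (Ω * (‖z‖ + 1))) * (Ω + Ω * (‖z‖ + 1) / 2) := by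
          have hBE : 0 ≤ 2 * B * Eη := by positivity
          gcongr
      _ = 2 * B * Eη * (Ω ^ 2 * (‖z‖ + 1) + Ω ^ 2 * (‖z‖ + 1) ^ 2 / 2) := by ring
      _ ≤ C * (1 + ‖z‖ ^ 2) := by
          rw [hC]
          have hBE : 0 ≤ 2 * B * Eη := by positivity
          have hΩ0 : 0 ≤ Ω := by positivity
          have h3 : Ω ^ 2 * (‖z‖ + 1) + Ω ^ 2 * (‖z‖ + 1) ^ 2 / 2 ≤
              (4 * Ω + 8 * Ω ^ 2) * (1 + ‖z‖ ^ 2) := by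
            nlinarith [sq_nonneg (‖z‖ - 1), sq_nonneg Ω, mul_nonneg hΩ0 hz0]
          calc 2 * B * Eη * (Ω ^ 2 * (‖z‖ + 1) + Ω ^ 2 * (‖z‖ + 1) ^ 2 / 2)
              ≤ 2 * B * Eη * ((4 * Ω + 8 * Ω ^ 2) * (1 + ‖z‖ ^ 2)) :=
                mul_le_mul_of_nonneg_left h3 hBE
            _ = 2 * B * Eη * (4 * Ω + 8 * Ω ^ 2) * (1 + ‖z‖ ^ 2) := by ring
  calc mσ * Real.exp (-(C * (1 + ‖z‖ ^ 2)))
      ≤ ‖L.weierstrassSigma (L.basis i * w)‖ * Real.exp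
          ((((m : ℂ) * L.η₁ + (n : ℂ) * L.η₂) * (L.basis i * w + lam / 2)).re) :=
        mul_le_mul (hmσle i _ hwK) (Real.exp_le_exp.mpr hexp) (by positivity) (norm_nonneg _)
    _ = Real.exp ((((m : ℂ) * L.η₁ + (n : ℂ) * L.η₂) * (L.basis i * w + lam / 2)).re) *
          ‖L.weierstrassSigma (L.basis i * w)‖ := mul_comm _ _

/-- **`|Φ| ≤ |G| · (c⁻¹ e^{C(1+|z|²)})^{4n}` on `ξ`** (the book's division by `P(ζ)`, `|P(ζ)| > 1`).
[cite: Masser1975, Lemma 1.10 (proof), Lemma 1.11 (proof)] -/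
theorem norm_biEval_le_of_mem_xiSet (d : DiscData L) :
    ∃ c : ℝ, 0 < c ∧ ∃ C : ℝ, 0 ≤ C ∧ ∀ (n : ℕ) (p : ℕ → ℕ → ℂ), ∀ z ∈ xiSet d,
      ‖biEval L n p z‖ ≤ ‖Gfun L n p z‖ * (c⁻¹ * Real.exp (C * (1 + ‖z‖ ^ 2))) ^ (4 * n) := by
  obtain ⟨c, hc, C, hC, hlow⟩ := le_norm_weierstrassSigma_of_mem_xiSet d
  refine ⟨c, hc, C, hC, fun n p z hz => ?_⟩
  have h1 : L.ω₁ * z ∉ L.lattice := by simpa using regular_of_mem_xiSet d hz 0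
  have h2 : L.ω₂ * z ∉ L.lattice := by simpa using regular_of_mem_xiSet d hz 1
  have hG := Gfun_eq n p h1 h2
  have hσ1 : c * Real.exp (-(C * (1 + ‖z‖ ^ 2))) ≤ ‖L.weierstrassSigma (L.ω₁ * z)‖ := by
    simpa using hlow z hz 0
  have hσ2 : c * Real.exp (-(C * (1 + ‖z‖ ^ 2))) ≤ ‖L.weierstrassSigma (L.ω₂ * z)‖ := by
    simpa using hlow z hz 1
  set e : ℝ := c * Real.exp (-(C * (1 + ‖z‖ ^ 2))) with he
  have he0 : 0 < e := by positivity
  have hmult : e ^ (4 * n) ≤ ‖sigmaMult L n z‖ := by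
    unfold sigmaMult
    rw [norm_mul, norm_pow, norm_pow, show 4 * n = 2 * n + 2 * n by ring, pow_add]
    exact mul_le_mul (pow_le_pow_left₀ he0.le hσ1 _) (pow_le_pow_left₀ he0.le hσ2 _)
      (by positivity) (by positivity)
  have hmult0 : 0 < ‖sigmaMult L n z‖ := lt_of_lt_of_le (by positivity) hmult
  have hinv : (c⁻¹ * Real.exp (C * (1 + ‖z‖ ^ 2))) = e⁻¹ := by
    rw [he, mul_inv, Real.exp_neg, inv_inv]
  have hΦ : ‖biEval L n p z‖ = ‖Gfun L n p z‖ / ‖sigmaMult L n z‖ := by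
    rw [hG, norm_mul, mul_div_cancel_left₀ _ hmult0.ne']
  rw [hΦ, hinv, inv_pow, div_eq_mul_inv]
  exact mul_le_mul_of_nonneg_left (inv_anti₀ (pow_pos he0 _) hmult) (norm_nonneg _)

/-! ### Periodicity and regularity of `Φ` -/

/-- `Φ` has period `1` (both `℘(ωᵢ z)` do): `Φ(z + s) = Φ(z)` for integers `s`.
[cite: Masser1975, §1.3 (proof of Lemma 1.10, "since Φ(z) has period 1")] -/
theorem biEval_add_intCast (n : ℕ) (p : ℕ → ℕ → ℂ) (z : ℂ) (s : ℤ) :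
    biEval L n p (z + s) = biEval L n p z := by
  unfold biEval
  simp only [scaledP_add_intCast]

/-- Hence the derivatives of `Φ` at `z + s` and at `z` agree. [folklore] -/
theorem iteratedDeriv_biEval_add_intCast (n : ℕ) (p : ℕ → ℕ → ℂ) (m : ℕ) (z : ℂ) (s : ℤ) :
    iteratedDeriv m (biEval L n p) (z + s) = iteratedDeriv m (biEval L n p) z := by
  have h : (fun w => biEval L n p (w + s)) = biEval L n p := funext fun w => biEval_add_intCast n p w s
  have := congrFun (iteratedDeriv_comp_add_const (n := m) (f := biEval L n p) (s := (s : ℂ))) z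
  rw [h] at this
  exact this.symm

/-- The regular set `{ω₁ z ∉ Λ} ∩ {ω₂ z ∉ Λ}` is open. [folklore] -/
theorem isOpen_regular : IsOpen {z : ℂ | L.ω₁ * z ∉ L.lattice ∧ L.ω₂ * z ∉ L.lattice} := by
  have h1 : IsOpen {z : ℂ | L.ω₁ * z ∉ L.lattice} :=
    L.isClosed_lattice.isOpen_compl.preimage (continuous_const.mul continuous_id)
  have h2 : IsOpen {z : ℂ | L.ω₂ * z ∉ L.lattice} :=
    L.isClosed_lattice.isOpen_compl.preimage (continuous_const.mul continuous_id)
  exact h1.inter h2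

/-- `Φ` is differentiable at the regular points. [folklore] -/
theorem differentiableAt_biEval (n : ℕ) (p : ℕ → ℕ → ℂ) {z : ℂ} (h1 : L.ω₁ * z ∉ L.lattice)
    (h2 : L.ω₂ * z ∉ L.lattice) : DifferentiableAt ℂ (biEval L n p) z := by
  have hd0 : DifferentiableAt ℂ (scaledP L 0) z :=
    (hasDerivAt_scaledP L 0 (by simpa using h1)).differentiableAt
  have hd1 : DifferentiableAt ℂ (scaledP L 1) z :=
    (hasDerivAt_scaledP L 1 (by simpa using h2)).differentiableAt
  unfold biEval
  fun_prop

/-- `Φ` is analytic at the regular points. [folklore] -/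
theorem analyticAt_biEval (n : ℕ) (p : ℕ → ℕ → ℂ) {z : ℂ} (h1 : L.ω₁ * z ∉ L.lattice)
    (h2 : L.ω₂ * z ∉ L.lattice) : AnalyticAt ℂ (biEval L n p) z := by
  refine DifferentiableOn.analyticAt (s := {w : ℂ | L.ω₁ * w ∉ L.lattice ∧ L.ω₂ * w ∉ L.lattice})
    (fun w hw => (differentiableAt_biEval n p hw.1 hw.2).differentiableWithinAt) ?_
  exact isOpen_regular.mem_nhds ⟨h1, h2⟩

/-! ### Derivatives of `G` from derivatives of `Φ` (Leibniz and Cauchy) -/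

variable (L) in
/-- **Cauchy for the multiplier**: `‖(σ(ω₁·)^{2n}σ(ω₂·)^{2n})^{(i)}(c)‖ ≤ i! exp(C(n+1)(1+(|c|+1)²))`
(Cauchy's inequality on the unit circle about `c`; Lemma 1.9: `|P_m(z)| < m^m Z^{c₁₁LZ²}`).
[cite: Masser1975, Lemma 1.9] -/
theorem norm_iteratedDeriv_sigmaMult_le : ∃ C : ℝ, 0 ≤ C ∧ ∀ (n i : ℕ) (c : ℂ),
    ‖iteratedDeriv i (sigmaMult L n) c‖ ≤
      i.factorial * Real.exp (C * (n + 1) * (1 + (‖c‖ + 1) ^ 2)) := by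
  obtain ⟨C, hC, hgrow⟩ := norm_sigmaMult_le L
  refine ⟨C, hC, fun n i c => ?_⟩
  have hdiff : DiffContOnCl ℂ (sigmaMult L n) (ball c 1) :=
    (differentiable_sigmaMult L n).diffContOnCl
  have hsphere : ∀ z ∈ sphere c 1, ‖sigmaMult L n z‖ ≤ Real.exp (C * (n + 1) * (1 + (‖c‖ + 1) ^ 2)) := by
    intro z hz
    refine (hgrow n z).trans (Real.exp_le_exp.mpr ?_)
    have hz' : ‖z‖ ≤ ‖c‖ + 1 := by
      have : ‖z - c‖ = 1 := mem_sphere_iff_norm.mp hz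
      calc ‖z‖ = ‖(z - c) + c‖ := by ring_nf
        _ ≤ ‖z - c‖ + ‖c‖ := norm_add_le _ _
        _ = ‖c‖ + 1 := by rw [this, add_comm]
    have : ‖z‖ ^ 2 ≤ (‖c‖ + 1) ^ 2 := pow_le_pow_left₀ (norm_nonneg _) hz' 2
    have h0 : 0 ≤ C * (n + 1) := by positivity
    nlinarith
  have h := Complex.norm_iteratedDeriv_le_of_forall_mem_sphere_norm_le i one_pos hdiff hsphere
  simpa using h

/-- **Leibniz**: at a regular point `c`,
`‖G^{(m)}(c)‖ ≤ ∑_{i ≤ m} binom(m,i) ‖(σ…)^{(i)}(c)‖ ‖Φ^{(m-i)}(c)‖` (`G = σ(ω₁z)^{2n}σ(ω₂z)^{2n}Φ`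
near `c`). [cite: Masser1975, §1.3 (proof of Lemma 1.10, eq. (13))] -/
theorem norm_iteratedDeriv_Gfun_le (n : ℕ) (p : ℕ → ℕ → ℂ) {c : ℂ} (h1 : L.ω₁ * c ∉ L.lattice)
    (h2 : L.ω₂ * c ∉ L.lattice) (m : ℕ) :
    ‖iteratedDeriv m (Gfun L n p) c‖ ≤ ∑ i ∈ Finset.range (m + 1), (m.choose i : ℝ) *
      ‖iteratedDeriv i (sigmaMult L n) c‖ * ‖iteratedDeriv (m - i) (biEval L n p) c‖ := by
  -- `G = u Φ` near `c`
  have hev : Gfun L n p =ᶠ[𝓝 c] (sigmaMult L n * biEval L n p) := by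
    filter_upwards [isOpen_regular.mem_nhds ⟨h1, h2⟩] with w hw
    exact Gfun_eq n p hw.1 hw.2
  rw [hev.iteratedDeriv_eq m]
  have hu : ContDiffAt ℂ m (sigmaMult L n) c := (differentiable_sigmaMult L n).contDiff.contDiffAt
  have hΦ : ContDiffAt ℂ m (biEval L n p) c := (analyticAt_biEval n p h1 h2).contDiffAt
  rw [iteratedDeriv_mul hu hΦ]
  refine (norm_sum_le _ _).trans (Finset.sum_le_sum fun i _ => ?_)
  rw [norm_mul, norm_mul, Complex.norm_natCast]

/-- **Cauchy on `∂𝒟`**: if `|Φ| ≤ B` on the circle `|z - 1/4| = ρ` then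
`‖Φ^{(m)}(1/4)‖ ≤ m! B / ρ^m` (end of the proof of Lemma 1.10).
[cite: Masser1975, Lemma 1.10 (proof, "We now use Cauchy's integral …")] -/
theorem norm_iteratedDeriv_biEval_quarter_le (d : DiscData L) (n : ℕ) (p : ℕ → ℕ → ℂ) {B : ℝ}
    (hB : ∀ z ∈ sphere (1 / 4 : ℂ) d.ρ, ‖biEval L n p z‖ ≤ B) (m : ℕ) :
    ‖iteratedDeriv m (biEval L n p) (1 / 4)‖ ≤ m.factorial * B / d.ρ ^ m := by
  have hreg : ∀ z ∈ closedBall (1 / 4 : ℂ) d.ρ, L.ω₁ * z ∉ L.lattice ∧ L.ω₂ * z ∉ L.lattice :=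
    fun z hz => ⟨by simpa using d.regular 0 z hz, by simpa using d.regular 1 z hz⟩
  have hdiff : DiffContOnCl ℂ (biEval L n p) (ball (1 / 4 : ℂ) d.ρ) := by
    refine ⟨fun z hz => ?_, fun z hz => ?_⟩
    · have h := hreg z (ball_subset_closedBall hz)
      exact (differentiableAt_biEval n p h.1 h.2).differentiableWithinAt
    · rw [closure_ball _ d.ρ_pos.ne'] at hz
      have h := hreg z hz
      exact (differentiableAt_biEval n p h.1 h.2).continuousAt.continuousWithinAt
  exact Complex.norm_iteratedDeriv_le_of_forall_mem_sphere_norm_le m d.ρ_pos hdiff hB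

/-- The points `s + 1/4` (`s ∈ ℤ`) are regular. [cite: Masser1975, Lemma 1.1] -/
theorem regular_intCast_add_quarter (s : ℤ) :
    L.ω₁ * ((s : ℂ) + 1 / 4) ∉ L.lattice ∧ L.ω₂ * ((s : ℂ) + 1 / 4) ∉ L.lattice := by
  have h1 : L.ω₁ * ((s : ℂ) + 1 / 4) = L.ω₁ / 4 + (s : ℂ) * L.ω₁ := by ring
  have h2 : L.ω₂ * ((s : ℂ) + 1 / 4) = L.ω₂ / 4 + (s : ℂ) * L.ω₂ := by ring
  have hq1 : L.ω₁ / 4 ∉ L.lattice := by simpa using basis_div_four_notMem L 0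
  have hq2 : L.ω₂ / 4 ∉ L.lattice := by simpa using basis_div_four_notMem L 1
  have hs1 : (s : ℂ) * L.ω₁ ∈ L.lattice := by
    simpa using (L.mul_ω₁_add_mul_ω₂_mem_lattice (α := s) (β := 0)).mpr (by simp)
  have hs2 : (s : ℂ) * L.ω₂ ∈ L.lattice := by
    simpa using (L.mul_ω₁_add_mul_ω₂_mem_lattice (α := 0) (β := s)).mpr (by simp)
  constructor
  · rw [h1]
    intro h
    exact hq1 (by simpa using sub_mem h hs1)
  · rw [h2]
    intro h
    exact hq2 (by simpa using sub_mem h hs2)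

end Literature.NumberTheory.Transcendental.Masser1975
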